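import Literature.AlgebraicGeometry.HodgeTheory.FermatCoordinateSection
import Literature.AlgebraicGeometry.HodgeTheory.FermatHypersurfaceReduction
import Literature.AlgebraicGeometry.HodgeTheory.ThomGysinClosedImmersion
import Literature.AlgebraicGeometry.HodgeTheory.HypersurfaceLefschetzUpper
import Literature.AlgebraicTopology.SingularHomology.CohomologyHomotopyInvariance
import Literature.AlgebraicTopology.SingularHomology.CohomologyOfPoint
import Mathlib.Analysis.SpecialFunctions.Complex.Log
import Mathlib.Analysis.Convex.Contractible
import HarnessLib

/-!
# The character eigenspaces `V(α)`, `α ≠ 0`, of the Fermat variety restrict injectively to the affine pieces `{x_k ≠ 0}` (Ran 1980 §1; Aoki 1987 p. 385)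

Family `hodge`, layer `Literature/AlgebraicGeometry/HodgeTheory`. PROOF FILE (everything below is a
theorem or an auxiliary definition with a body; no named fact is introduced, D-0026) — the first
stage of the tree's proof of the multiplicity-one statement "`dim V(α) = 1`" for the character
eigenspaces `V(α) ⊆ Hⁿ(Xⁿₘ(ℂ); ℂ)` of the Fermat variety `Xⁿₘ : Σ xᵢᵐ = 0` (N. Aoki, *Some new
algebraic cycles on Fermat varieties*, J. Math. Soc. Japan 39 (1987), p. 385: "It is well known
(see [3], [4]) that `dim V(α) = 1` for `α ∈ 𝔄ⁿₘ`"; Z. Ran, *Cycles on Fermat hypersurfaces*,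
Compositio Math. 42 (1980), §1 Prop. 1.7 (i): "the character decomposition of `Pₙ(Vⁿₘ)` is
`⊕ {H_χ : χ relevant}` with each `H_χ` 1-dimensional"; the hypothesis `hE1` of every assembly of
`FermatInductiveClaims*`, `FermatJuxtapositionGysin`, `FermatLinearSubspaceClass`,
`ShiodaClaimPairedProofs`). The printed road (Ran §1, before Prop. 1.7, and Lemma 1.4; Shioda,
Math. Ann. 245 (1979) §1; Pham 1965 / Milnor 1968 §9 for the affine pieces) reads the
representation of `μₘⁿ⁺²` on `Hⁿ(Xⁿₘ(ℂ); ℂ)` off the affine Fermat varieties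
`U_k = Xⁿₘ ∖ {x_k = 0} ≅ {Σ yⱼᵐ = -1}`; this file supplies the passage from `Xⁿₘ` to `U_k`:

* `map_diagonalProjMap_eq_id` — **projective linear (diagonal) transformations act trivially on
  `H*(ℙᴺ(ℂ); M)`**: `[z] ↦ [a • z]` is homotopic to the identity through the torus
  (`t ↦ [exp(t log aᵢ) zᵢ]`, a homotopy on the quotient `ℙ(ℂᴺ⁺¹)` of `ℂᴺ⁺¹ ∖ 0`, transported to
  the complex points `ℙᴺ_ℂ(ℂ)` along Serre's comparison `projPoint`), and homotopic maps agree on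
  singular cohomology (Hatcher §3.1; the tree's `singularCohomology.map_eq_of_homotopic'`);
* `map_diagonalAut_map_hypersurfaceι` — hence **the diagonal symmetries `g_a` of a hypersurface
  `X_F` fix every class restricted from projective space**, `g_a^* (ι^* η) = ι^* η`;
* `restrictCompl_map_eq_zero_of_stdChartSource` — **classes restricted from `ℙⁿ⁺¹` die on a
  Zariski-open piece lying over one standard affine chart** `{z_k ≠ 0} ≅ ℂⁿ⁺¹` (contractible:
  positive-degree cohomology vanishes);
* `ker_restrictCompl_fermatCoordHyperplane_le_span` — for the Fermat variety `Xⁿ⁺¹ₘ ⊂ ℙⁿ⁺²`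
  (`n, m ≥ 1`) and an even degree `2p + 2` with `2p < n`: **the kernel of the restriction
  `H²ᵖ⁺²(Xⁿ⁺¹ₘ(ℂ)) → H²ᵖ⁺²(U_k(ℂ))` is the line `ℂ · ι^* γ`** spanned by a class restricted from
  `ℙⁿ⁺²(ℂ)`: it is the Gysin image of `H²ᵖ(Xⁿₘ(ℂ))` under the coordinate section
  `Xⁿₘ ≅ Xⁿ⁺¹ₘ ∩ {x_k = 0}` (Thom–Gysin exactness for the smooth divisor, the tree's
  `ker_restrictCompl_eq_range_complexGysin_of_isClosedImmersion`, Voisin II §6.1.1), of dimension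
  `≤ dim H²ᵖ(Xⁿₘ(ℂ)) ≤ dim H²ᵖ(ℙⁿ⁺¹(ℂ)) = 1` (Lefschetz in the lower range `2p < n = dim Xⁿₘ`,
  the tree's `surjective_map_of_lt`), and it contains `ι^* γ ≠ 0` (previous item and the degree
  of a smooth hypersurface, `map_ne_zero_of_le`);
* `map_diagonalMap_eq_self_of_restrictCompl_eq_zero` — so **`μₘⁿ⁺³` acts trivially on that
  kernel**, and
* `fermatEigenspace_inf_ker_restrictCompl_eq_bot`, `restrictCompl_injOn_fermatEigenspace` —
  **for every character `α ≠ 0` the eigenspace `V(α) ⊆ H²ᵖ⁺²(Xⁿ⁺¹ₘ(ℂ); ℂ)` meets the kernel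
  trivially, i.e. restriction to `U_k(ℂ)` is injective on `V(α)`** (Ran's "`P_i(X) = ⊕_{χ ≠ 0}`",
  (1.5), in the tree's cycle-map-free language; in the middle degree `2p + 2 = n + 1` this is the
  input "`V(α) ↪ Hⁿ⁺¹(U_k(ℂ); ℂ)`" of the multiplicity-one count on the affine piece, whose
  cohomology is Pham's join computation, files `Geometry/ComplexAnalytic/PhamBrieskorn*`,
  `FermatAffineChart`).

Nothing here uses Hodge theory; the orientation family of the Gysin morphism is the tree's
`Motives.ComplexPoints.isOrientableOver` (any choice).

## References

* [Aoki1987] N. Aoki, Some new algebraic cycles on Fermat varieties, J. Math. Soc. Japan 39 (1987)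
  385–396, p. 385 (text read: J-STAGE open copy, PDF p. 1).
* [Ran1980] Z. Ran, Cycles on Fermat hypersurfaces, Compositio Math. 42 (1980) 121–142, §1
  (1.1)–(1.5), Lemma 1.4, Prop. 1.7 (i) (text read: Numdam copy, PDF pp. 4–6).
* [Shioda1979HodgeFermat] T. Shioda, The Hodge conjecture for Fermat varieties, Math. Ann. 245
  (1979) 175–184, §1 (cite-only).
* [VoisinHodgeII2003] C. Voisin, Hodge Theory and Complex Algebraic Geometry II, §1.2.2 Thm. 1.23,
  §1.2.3 Cor. 1.25, §6.1.1 (Thom–Gysin sequence).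
* [HatcherAT2002] A. Hatcher, Algebraic Topology, CUP 2002, §3.1 p. 201 (homotopy invariance),
  Thm. 3.19 (`H*(ℂℙᴺ)`).
-/

noncomputable section

open CategoryTheory AlgebraicGeometry Topology
open scoped LinearAlgebra.Projectivization unitInterval

namespace Literature.AlgebraicGeometry.HodgeTheory

open Literature.AlgebraicGeometry.Motives Literature.AlgebraicTopology.SingularHomology
  Literature.NumberTheory.Transcendental

/-! ### Projective linear (diagonal) transformations are homotopic to the identity -/

section Projective

variable {N : ℕ}

/-- The self-map `[v] ↦ [a • v]` of `ℙ(ℂᴺ⁺¹)` (as a bare function). [folklore] -/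
def projSmulFun (a : Fin (N + 1) → ℂˣ) (p : ℙ ℂ (Fin (N + 1) → ℂ)) : ℙ ℂ (Fin (N + 1) → ℂ) :=
  Projectivization.mk ℂ (a • p.rep) ((smul_ne_zero_iff_ne a).mpr p.rep_nonzero)

/-- `[v] ↦ [a • v]` on representatives. [folklore] -/
theorem projSmulFun_mk (a : Fin (N + 1) → ℂˣ) (v : Fin (N + 1) → ℂ) (hv : v ≠ 0) :
    projSmulFun a (Projectivization.mk ℂ v hv) =
      Projectivization.mk ℂ (a • v) ((smul_ne_zero_iff_ne a).mpr hv) := by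
  unfold projSmulFun
  obtain ⟨c, hc⟩ := Projectivization.exists_smul_eq_mk_rep ℂ v hv
  rw [Projectivization.mk_eq_mk_iff']
  refine ⟨(c : ℂ), ?_⟩
  rw [← hc, Units.smul_def, smul_comm]

/-- The path `t ↦ (exp(t log aᵢ))ᵢ` in the diagonal torus, from `1` (`t = 0`) to `a` (`t = 1`).
[folklore] -/
def unitPath (a : Fin (N + 1) → ℂˣ) (t : ℝ) : Fin (N + 1) → ℂˣ := fun i ↦
  Units.mk0 (Complex.exp (t * Complex.log (a i))) (Complex.exp_ne_zero _)

/-- `unitPath a 0 = 1`. [folklore] -/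
theorem unitPath_zero (a : Fin (N + 1) → ℂˣ) : unitPath a 0 = 1 := by
  funext i; ext; simp [unitPath]

/-- `unitPath a 1 = a`. [folklore] -/
theorem unitPath_one (a : Fin (N + 1) → ℂˣ) : unitPath a 1 = a := by
  funext i; ext; simp [unitPath, Complex.exp_log (a i).ne_zero]

/-- Joint continuity of `(t, v) ↦ unitPath a t • v`. [folklore] -/
theorem continuous_unitPath_smul (a : Fin (N + 1) → ℂˣ) :
    Continuous fun q : ℝ × (Fin (N + 1) → ℂ) ↦ unitPath a q.1 • q.2 := by
  refine continuous_pi fun i ↦ ?_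
  change Continuous fun q : ℝ × (Fin (N + 1) → ℂ) ↦ (unitPath a q.1 i : ℂ) * q.2 i
  simp only [unitPath, Units.val_mk0]
  fun_prop

/-- Joint continuity of `(t, [v]) ↦ [unitPath a t • v]` on `I × ℙ(ℂᴺ⁺¹)`: the quotient map
`ℂᴺ⁺¹ ∖ 0 → ℙ(ℂᴺ⁺¹)` is an open quotient map (the tree's `Projectivization.isOpenQuotientMap_mk`),
hence so is its product with `I`. [folklore] -/
theorem continuous_projSmulFun_unitPath (a : Fin (N + 1) → ℂˣ) :
    Continuous fun q : I × ℙ ℂ (Fin (N + 1) → ℂ) ↦ projSmulFun (unitPath a q.1) q.2 := by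
  have hq : IsOpenQuotientMap (Prod.map (id : I → I)
      (fun v : {v : Fin (N + 1) → ℂ // v ≠ 0} ↦ Projectivization.mk ℂ (v : Fin (N + 1) → ℂ) v.2)) :=
    IsOpenQuotientMap.id.prodMap Projectivization.isOpenQuotientMap_mk
  rw [hq.isQuotientMap.continuous_iff]
  have h2 : (fun q : I × ℙ ℂ (Fin (N + 1) → ℂ) ↦ projSmulFun (unitPath a q.1) q.2) ∘
      Prod.map (id : I → I) (fun v : {v : Fin (N + 1) → ℂ // v ≠ 0} ↦
        Projectivization.mk ℂ (v : Fin (N + 1) → ℂ) v.2) =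
      fun q ↦ Projectivization.mk' ℂ ⟨unitPath a q.1 • (q.2 : Fin (N + 1) → ℂ),
        (smul_ne_zero_iff_ne _).mpr q.2.2⟩ := by
    funext ⟨t, v⟩
    simp only [Function.comp_apply, Prod.map_apply, id_eq, projSmulFun_mk]
    rfl
  rw [h2]
  refine Projectivization.continuous_mk'.comp ?_
  refine Continuous.subtype_mk ?_ _
  exact (continuous_unitPath_smul a).comp
    ((continuous_subtype_val.comp continuous_fst).prodMk (continuous_subtype_val.comp continuous_snd))

/-- `[v] ↦ [a • v]` is continuous. [folklore] -/
theorem continuous_projSmulFun (a : Fin (N + 1) → ℂˣ) : Continuous (projSmulFun a) := by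
  have h := (continuous_projSmulFun_unitPath a).comp (Continuous.prodMk_right (1 : I))
  simp only [Function.comp_def] at h
  rwa [show ((1 : I) : ℝ) = 1 from rfl, unitPath_one] at h

/-- **The projective linear transformation `[v] ↦ [a • v]` of `ℙ(ℂᴺ⁺¹)`** of a diagonal matrix
`a ∈ (ℂˣ)ᴺ⁺¹`, as a continuous self-map of Mathlib's projectivization with the analytic (quotient)
topology of `Literature/NumberTheory/Transcendental/ProjectiveSpace`. [folklore] -/
def projSmul (a : Fin (N + 1) → ℂˣ) : C(ℙ ℂ (Fin (N + 1) → ℂ), ℙ ℂ (Fin (N + 1) → ℂ)) :=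
  ⟨projSmulFun a, continuous_projSmulFun a⟩

/-- `projSmul a [v] = [a • v]`. [folklore] -/
theorem projSmul_mk (a : Fin (N + 1) → ℂˣ) (v : Fin (N + 1) → ℂ) (hv : v ≠ 0) :
    projSmul a (Projectivization.mk ℂ v hv) =
      Projectivization.mk ℂ (a • v) ((smul_ne_zero_iff_ne a).mpr hv) :=
  projSmulFun_mk a v hv

/-- **The homotopy `(t, [v]) ↦ [unitPath a t • v]` from the identity to `projSmul a`** (the
diagonal torus `(ℂˣ)ᴺ⁺¹` is path connected). [folklore] -/
def projSmulHomotopy (a : Fin (N + 1) → ℂˣ) :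
    ContinuousMap.Homotopy (ContinuousMap.id (ℙ ℂ (Fin (N + 1) → ℂ))) (projSmul a) where
  toFun q := projSmulFun (unitPath a q.1) q.2
  continuous_toFun := continuous_projSmulFun_unitPath a
  map_zero_left p := by
    change projSmulFun (unitPath a 0) p = p
    rw [unitPath_zero]
    unfold projSmulFun
    simp only [one_smul, Projectivization.mk_rep]
  map_one_left p := by
    change projSmulFun (unitPath a 1) p = projSmulFun a p
    rw [unitPath_one]

/-- `projSmul a` is homotopic to the identity. [folklore] -/
theorem projSmul_homotopic_id (a : Fin (N + 1) → ℂˣ) :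
    (projSmul a).Homotopic (ContinuousMap.id _) :=
  ⟨(projSmulHomotopy a).symm⟩

variable {n : ℕ}

/-- Serre's comparison `ℙ(ℂⁿ⁺²) ≃ₜ ℙⁿ⁺¹_ℂ(ℂ)` as a homeomorphism (the tree's `projPoint` with
`isHomeomorph_projPoint`, GAGA §2 n°5). [folklore] -/
def projPointHomeomorph (n : ℕ) : ℙ ℂ (Fin (n + 2) → ℂ) ≃ₜ ComplexPoints (projectiveSpace (n + 1) ℂ) :=
  (isHomeomorph_projPoint (n + 1)).homeomorph (projPoint (n + 1))

/-- `projPointHomeomorph n p = projPoint (n + 1) p`. [folklore] -/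
@[simp] theorem projPointHomeomorph_apply (p : ℙ ℂ (Fin (n + 2) → ℂ)) :
    projPointHomeomorph n p = projPoint (n + 1) p := rfl

/-- On complex points the projective linear transformation `diagonalProjMap a` of the scheme
`ℙⁿ⁺¹_ℂ` IS `projSmul a` through the comparison `projPoint` (the tree's
`map_diagonalProjMap_projPoint`). [folklore] -/
theorem mapContinuous_diagonalProjMap_projPoint (a : Fin (n + 2) → ℂˣ) (p : ℙ ℂ (Fin (n + 2) → ℂ)) :
    AlgPoints.mapContinuous (L := ℂ) (diagonalProjMap a) (projPoint (n + 1) p) =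
      projPoint (n + 1) (projSmul a p) := by
  induction p using Projectivization.ind with
  | h v hv =>
    change AlgPoints.map (diagonalProjMap a) (projPoint (n + 1) (Projectivization.mk ℂ v hv)) = _
    rw [map_diagonalProjMap_projPoint]
    change _ = projPoint (n + 1) (projSmulFun a (Projectivization.mk ℂ v hv))
    rw [projSmulFun_mk]

/-- `diagonalProjMap a` on complex points is conjugate to `projSmul a` by `projPointHomeomorph`.
[folklore] -/
theorem mapContinuous_diagonalProjMap_eq (a : Fin (n + 2) → ℂˣ) :
    AlgPoints.mapContinuous (L := ℂ) (diagonalProjMap a) =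
      (projPointHomeomorph n : C(ℙ ℂ (Fin (n + 2) → ℂ), ComplexPoints (projectiveSpace (n + 1) ℂ))).comp
        ((projSmul a).comp
          ((projPointHomeomorph n).symm : C(ComplexPoints (projectiveSpace (n + 1) ℂ), ℙ ℂ (Fin (n + 2) → ℂ)))) := by
  refine ContinuousMap.ext fun P ↦ ?_
  obtain ⟨p, rfl⟩ := (projPointHomeomorph n).surjective P
  rw [ContinuousMap.comp_apply, ContinuousMap.comp_apply, ContinuousMap.coe_coe, ContinuousMap.coe_coe,
    Homeomorph.symm_apply_apply, projPointHomeomorph_apply, mapContinuous_diagonalProjMap_projPoint]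
  rfl

/-- **`diagonalProjMap a` is homotopic to the identity on `ℙⁿ⁺¹_ℂ(ℂ)`.** [folklore] -/
theorem mapContinuous_diagonalProjMap_homotopic_id (a : Fin (n + 2) → ℂˣ) :
    (AlgPoints.mapContinuous (L := ℂ) (diagonalProjMap a)).Homotopic (ContinuousMap.id _) := by
  set e := (projPointHomeomorph n : C(ℙ ℂ (Fin (n + 2) → ℂ), ComplexPoints (projectiveSpace (n + 1) ℂ)))
  set e' := ((projPointHomeomorph n).symm : C(ComplexPoints (projectiveSpace (n + 1) ℂ), ℙ ℂ (Fin (n + 2) → ℂ)))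
  have hee' : e.comp e' = ContinuousMap.id _ := by
    refine ContinuousMap.ext fun P ↦ ?_
    simp [e, e']
  rw [mapContinuous_diagonalProjMap_eq]
  change (e.comp ((projSmul a).comp e')).Homotopic (ContinuousMap.id _)
  have h1 : (e.comp ((projSmul a).comp e')).Homotopic (e.comp ((ContinuousMap.id _).comp e')) :=
    (ContinuousMap.Homotopic.refl e).comp ((projSmul_homotopic_id a).comp (ContinuousMap.Homotopic.refl e'))
  refine h1.trans ?_
  rw [ContinuousMap.id_comp, hee']

/-- **Projective linear (diagonal) transformations act trivially on `Hᵏ(ℙⁿ⁺¹(ℂ); M)`**: the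
pull-back along `diagonalProjMap a` is the identity, by homotopy invariance of singular cohomology
(Hatcher §3.1 p. 201; the tree's `singularCohomology.map_eq_of_homotopic'`).
[cite: HatcherAT2002, §3.1 p. 201] -/
theorem map_diagonalProjMap_eq_id (R M : Type) [CommRing R] [AddCommGroup M] [Module R M]
    (a : Fin (n + 2) → ℂˣ) (k : ℕ) :
    singularCohomology.map R M (AlgPoints.mapContinuous (L := ℂ) (diagonalProjMap a)) k = 𝟙 _ := by
  rw [singularCohomology.map_eq_of_homotopic' R M (mapContinuous_diagonalProjMap_homotopic_id a) k,
    singularCohomology.map_id]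

/-- `(diagonalProjMap a)^* = 𝟙` on `Hᵏ(ℙⁿ⁺¹(ℂ); ℂ) = complexBetti`. [cite: HatcherAT2002, §3.1 p. 201] -/
theorem complexBetti_map_diagonalProjMap (a : Fin (n + 2) → ℂˣ) (k : ℕ) :
    complexBetti.map (diagonalProjMap a) k = 𝟙 _ :=
  map_diagonalProjMap_eq_id ℂ ℂ a k

end Projective

/-! ### Diagonal symmetries of a hypersurface fix the classes restricted from projective space -/

section Hypersurface

variable {n : ℕ} (F : MvPolynomial (Fin (n + 2)) ℂ) {a : Fin (n + 2) → ℂˣ}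

/-- **`g_a^* (ι^* η) = ι^* η`**: a diagonal symmetry `g_a = diagonalAut F ha` of the hypersurface
`X_F ⊂ ℙⁿ⁺¹` fixes every class restricted from `ℙⁿ⁺¹(ℂ)` (`g_a ≫ ι = ι ≫ [z ↦ a • z]` and the
latter acts trivially on `H*(ℙⁿ⁺¹(ℂ))`). [cite: Ran1980, §1 (1.1)–(1.3)] -/
theorem map_diagonalAut_map_hypersurfaceι (ha : a ∈ diagonalStabilizer F) (k : ℕ)
    (η : complexBetti (projectiveSpace (n + 1) ℂ) k) :
    complexBetti.map (diagonalAut F ha) k (complexBetti.map (SmoothHypersurface.hypersurfaceι F) k η) =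
      complexBetti.map (SmoothHypersurface.hypersurfaceι F) k η := by
  rw [← ModuleCat.comp_apply, ← complexBetti.map_comp, diagonalAut_comp_ι, complexBetti.map_comp,
    complexBetti_map_diagonalProjMap, Category.id_comp]

/-- The same through the continuous self-map `diagonalMap F ha = g_a(ℂ)` of `X_F(ℂ)` (the spelling
of `mem_diagonalCharacterEigenspace_iff_diagonalMap` / `mem_fermatEigenspace_iff`).
[cite: Ran1980, §1 (1.1)–(1.3)] -/
theorem map_diagonalMap_map_hypersurfaceι (ha : a ∈ diagonalStabilizer F) (k : ℕ)
    (η : complexBetti (projectiveSpace (n + 1) ℂ) k) :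
    singularCohomology.map ℂ ℂ (diagonalMap F ha) k
        (complexBetti.map (SmoothHypersurface.hypersurfaceι F) k η) =
      complexBetti.map (SmoothHypersurface.hypersurfaceι F) k η :=
  map_diagonalAut_map_hypersurfaceι F ha k η

end Hypersurface

/-! ### Classes restricted from projective space die over one standard affine chart -/

section Chart

variable {n : ℕ}

/-- The standard chart domain `{z_k ≠ 0} ⊂ ℙ(ℂⁿ⁺²)` is contractible (it is homeomorphic to `ℂⁿ⁺¹`
through the tree's `Projectivization.stdChart k`). [folklore] -/
theorem contractibleSpace_stdChartSource (k : Fin (n + 2)) :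
    ContractibleSpace (Projectivization.stdChartSource (𝕜 := ℂ) (n := n + 1) k) := by
  let e : (Projectivization.stdChartSource (𝕜 := ℂ) (n := n + 1) k) ≃ₜ (Set.univ : Set (Fin (n + 1) → ℂ)) :=
    (Projectivization.stdChart (𝕜 := ℂ) k).toHomeomorphSourceTarget
  exact (e.trans (Homeomorph.Set.univ (Fin (n + 1) → ℂ))).contractibleSpace_iff.mpr inferInstance

/-- Positive-degree cohomology of a contractible space vanishes (Hatcher §3.1: `Hʲ(pt) = 0`,
`j > 0`, and homotopy invariance; re-derived from the tree's `isoOfContractible` to keep the import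
closure small). [cite: HatcherAT2002, §3.1 p. 201] -/
theorem isZero_singularCohomology_of_contractibleSpace' (R M : Type) [CommRing R] [AddCommGroup M]
    [Module R M] (S : Type) [TopologicalSpace S] [ContractibleSpace S] {j : ℕ} (hj : j ≠ 0) :
    Limits.IsZero (singularCohomology R M S j) :=
  (singularCochainComplex.isZero_singularCohomology_of_subsingleton' (R := R) (M := M)
    (X := PUnit.{1}) hj).of_iso (singularCohomology.isoOfContractible R M S j).symm

/-- **Classes restricted from `ℙⁿ⁺¹(ℂ)` die on a piece lying over one standard chart.** Let
`ι : Y ⟶ ℙⁿ⁺¹_ℂ` and `Z ⊆ Y` be such that every complex point off `Z` has homogeneous coordinate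
`z_k ≠ 0`. Then for `j ≠ 0` and every `η ∈ Hʲ(ℙⁿ⁺¹(ℂ))`, the restriction of `ι^* η` to
`(Y ∖ Z)(ℂ)` vanishes: it factors through `Hʲ({z_k ≠ 0}) = Hʲ(ℂⁿ⁺¹) = 0`.
[cite: Ran1980, §1 Lemma 1.4 (proof)] -/
theorem restrictCompl_map_eq_zero_of_stdChartSource {Y : SchemeOver ℂ}
    (ι : Y ⟶ projectiveSpace (n + 1) ℂ) {Z : Set Y.left} (k : Fin (n + 2))
    (hZ : ∀ P : ComplexPoints Y, P.pt ∉ Z → hypersurfacePoint ι P ∈ Projectivization.stdChartSource k)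
    {j : ℕ} (hj : j ≠ 0) (η : complexBetti (projectiveSpace (n + 1) ℂ) j) :
    complexBetti.restrictCompl Y Z j (complexBetti.map ι j η) = 0 := by
  -- the continuous maps
  set S : Set (ℙ ℂ (Fin (n + 2) → ℂ)) := Projectivization.stdChartSource k
  haveI : ContractibleSpace S := contractibleSpace_stdChartSource k
  let incl : C(complexPointsCompl Y Z, ComplexPoints Y) := ⟨Subtype.val, continuous_subtype_val⟩
  let r : C(complexPointsCompl Y Z, S) :=
    ⟨fun P ↦ ⟨hypersurfacePoint ι P.1, hZ P.1 P.2⟩,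
      (continuous_hypersurfacePoint ι).comp continuous_subtype_val |>.subtype_mk _⟩
  let sval : C(S, ℙ ℂ (Fin (n + 2) → ℂ)) := ⟨Subtype.val, continuous_subtype_val⟩
  let e := (projPointHomeomorph n : C(ℙ ℂ (Fin (n + 2) → ℂ), ComplexPoints (projectiveSpace (n + 1) ℂ)))
  have hfac : (AlgPoints.mapContinuous (L := ℂ) ι).comp incl = e.comp (sval.comp r) := by
    refine ContinuousMap.ext fun P ↦ ?_
    change AlgPoints.map ι P.1 = projPointHomeomorph n (hypersurfacePoint ι P.1)
    rw [projPointHomeomorph_apply, projPoint_hypersurfacePoint]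
  -- the class on `S` vanishes
  have h0 : singularCohomology.map ℂ ℂ sval j (singularCohomology.map ℂ ℂ e j η) = 0 := by
    have hz := isZero_singularCohomology_of_contractibleSpace' ℂ ℂ S hj
    exact (ModuleCat.subsingleton_of_isZero hz).elim _ _
  change singularCohomology.map ℂ ℂ incl j (singularCohomology.map ℂ ℂ (AlgPoints.mapContinuous (L := ℂ) ι) j η) = 0
  rw [← ModuleCat.comp_apply, ← singularCohomology.map_comp, hfac, singularCohomology.map_comp,
    singularCohomology.map_comp, ModuleCat.comp_apply, ModuleCat.comp_apply, h0, map_zero]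

end Chart

/-! ### The Fermat variety: the kernel of restriction to `U_k = {x_k ≠ 0}` is the line of ambient classes -/

section Fermat

variable {n m : ℕ}

/-- Local notation: the standard Fermat hypersurface `Xⁿₘ`. -/
local notation "𝕏" n' ", " m' => fermatHypersurface n' m'

/-- Local notation: its closed immersion into projective space. -/
local notation "ιX" n' ", " m' => SmoothHypersurface.hypersurfaceι (fermatPolynomial ℂ n' m')

/-- An orientation family for the Gysin morphisms (any choice; the tree's
`Motives.ComplexPoints.isOrientableOver`). [folklore] -/
def fermatOrientationFamily : OrientationFamily := fun _ _ hY ↦ (ComplexPoints.isOrientableOver ℂ hY).some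

/-- **Classes of `Xⁿ⁺¹ₘ` restricted from `ℙⁿ⁺²(ℂ)` die on `U_k(ℂ) = (Xⁿ⁺¹ₘ ∖ {x_k = 0})(ℂ)`** in
positive degree (`U_k` lies over the contractible chart `{z_k ≠ 0}`,
`notMem_fermatCoordHyperplane_iff`). [cite: Ran1980, §1 Lemma 1.4 (proof)] -/
theorem restrictCompl_fermatCoordHyperplane_map_eq_zero {N : ℕ} (k : Fin (N + 2)) {j : ℕ} (hj : j ≠ 0)
    (η : complexBetti (projectiveSpace (N + 1) ℂ) j) :
    complexBetti.restrictCompl (𝕏 N, m) (fermatCoordHyperplane N m k) j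
      (complexBetti.map (ιX N, m) j η) = 0 :=
  restrictCompl_map_eq_zero_of_stdChartSource (ιX N, m) k
    (fun P hP ↦ (notMem_fermatCoordHyperplane_iff k P).mp hP) hj η

variable (hn : 1 ≤ n) (hm : 1 ≤ m)
include hn hm

/-- **Thom–Gysin for the coordinate section.** The kernel of
`H²ᵖ⁺²(Xⁿ⁺¹ₘ(ℂ)) → H²ᵖ⁺²(U_k(ℂ))` is the Gysin image of `H²ᵖ(Xⁿₘ(ℂ))` under the smooth divisor
`fermatSection : Xⁿₘ ≅ Xⁿ⁺¹ₘ ∩ {x_k = 0} ↪ Xⁿ⁺¹ₘ` (the tree's unconditional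
`ker_restrictCompl_eq_range_complexGysin_of_isClosedImmersion` and `range_fermatSection`).
[cite: VoisinHodgeII2003, §6.1.1 (Thom–Gysin sequence)] [cite: Ran1980, §1 Lemma 1.4] -/
theorem ker_restrictCompl_fermatCoordHyperplane_eq_range (k : Fin (n + 3)) (p : ℕ) :
    LinearMap.ker (complexBetti.restrictCompl (𝕏 (n + 1), m) (fermatCoordHyperplane (n + 1) m k)
        (2 * p + 2)).hom =
      LinearMap.range (complexGysin fermatOrientationFamily
        (isSmoothProjective_fermatHypersurface hn hm)
        (isSmoothProjective_fermatHypersurface (Nat.le_add_left 1 n) hm)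
        (fermatSection (m := m) (by omega) k)
        (show 2 * p + 2 * (n + 1) = (2 * p + 2) + 2 * n by ring)) := by
  have h := ker_restrictCompl_eq_range_complexGysin_of_isClosedImmersion fermatOrientationFamily
    (isSmoothProjective_fermatHypersurface (Nat.le_add_left 1 n) hm)
    (isSmoothProjective_fermatHypersurface hn hm) (fermatSection (m := m) (by omega) k)
    (show 2 * p + 2 * (n + 1) = (2 * p + 2) + 2 * n by ring)
  have hr : Set.range (fermatSection (n := n) (m := m) (by omega) k).left.base =
      fermatCoordHyperplane (n + 1) m k := range_fermatSection (by omega) k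
  rw [hr] at h
  exact h

/-- **The kernel has dimension `≤ 1` for `2p < n`**: it is a quotient of `H²ᵖ(Xⁿₘ(ℂ))`, onto which
`H²ᵖ(ℙⁿ⁺¹(ℂ)) ≅ ℂ` surjects (Lefschetz in the lower range for the smooth hypersurface `Xⁿₘ`, the
tree's `surjective_map_of_lt`; `dim H²ᵖ(ℙⁿ⁺¹(ℂ)) = 1`).
[cite: VoisinHodgeII2003, §1.2.2 Thm. 1.23] [cite: HatcherAT2002, Thm. 3.19] -/
theorem finrank_ker_restrictCompl_fermatCoordHyperplane_le_one (k : Fin (n + 3)) {p : ℕ} (hp : 2 * p < n) :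
    Module.finrank ℂ (LinearMap.ker (complexBetti.restrictCompl (𝕏 (n + 1), m)
      (fermatCoordHyperplane (n + 1) m k) (2 * p + 2)).hom) ≤ 1 := by
  have hY : IsSmoothHypersurface n m (𝕏 n, m) := isSmoothHypersurface_fermatHypersurface hn hm
  have hP : IsSmoothProjective (n + 1) (projectiveSpace (n + 1) ℂ) :=
    isSmoothProjective_projectiveSpace_holds ℂ (n + 1)
  haveI := finite_complexBetti hY.1 (2 * p)
  rw [ker_restrictCompl_fermatCoordHyperplane_eq_range hn hm k p]
  refine (LinearMap.finrank_range_le _).trans ?_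
  -- `dim H²ᵖ(Xⁿₘ(ℂ)) ≤ dim H²ᵖ(ℙⁿ⁺¹(ℂ)) = 1`
  obtain ⟨F, hFhom, hFirr, hred, ι, hι, hrange⟩ := hY.2
  haveI := hι
  calc Module.finrank ℂ (complexBetti (𝕏 n, m) (2 * p))
      ≤ Module.finrank ℂ (complexBetti (projectiveSpace (n + 1) ℂ) (2 * p)) :=
        finrank_complexBetti_le_of_surjective hP ι _ (surjective_map_of_lt hY hFhom hFirr ι hrange hp)
    _ = 1 := finrank_complexBetti_projectiveSpace_two_mul (n + 1) (by omega)

/-- **A non-zero ambient class in the kernel**: there is `γ ∈ H²ᵖ⁺²(ℙⁿ⁺²(ℂ))` with `ι^* γ ≠ 0`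
(`p + 1 ≤ n + 1`; the degree of the smooth hypersurface `Xⁿ⁺¹ₘ` is non-zero, the tree's
`map_ne_zero_of_le`), and `ι^* γ` dies on `U_k(ℂ)`. [cite: VoisinHodgeII2003, §1.2.3 Cor. 1.25] -/
theorem exists_map_hypersurfaceι_ne_zero {p : ℕ} (hp : p ≤ n) :
    ∃ γ : complexBetti (projectiveSpace (n + 2) ℂ) (2 * p + 2),
      complexBetti.map (ιX (n + 1), m) (2 * p + 2) γ ≠ 0 := by
  have hX : IsSmoothProjective (n + 1) (𝕏 (n + 1), m) := isSmoothProjective_fermatHypersurface (by omega) hm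
  -- a non-zero class of `H²ᵖ⁺²(ℙⁿ⁺²(ℂ)) ≅ ℂ`
  obtain ⟨γ, hγ⟩ : ∃ γ : complexBetti (projectiveSpace (n + 2) ℂ) (2 * (p + 1)), γ ≠ 0 := by
    have h1 := finrank_complexBetti_projectiveSpace_two_mul (n + 2) (k := p + 1) (by omega)
    by_contra hcon
    push Not at hcon
    haveI : Subsingleton (complexBetti (projectiveSpace (n + 2) ℂ) (2 * (p + 1))) :=
      ⟨fun a b ↦ by rw [hcon a, hcon b]⟩
    have : Module.finrank ℂ (complexBetti (projectiveSpace (n + 2) ℂ) (2 * (p + 1))) = 0 :=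
      Module.finrank_zero_of_subsingleton
    omega
  refine ⟨γ, ?_⟩
  exact map_ne_zero_of_le (n := n + 1) hX (isHomogeneous_fermatPolynomial (n + 1) m)
    (irreducible_fermatPolynomial_of_isAlgClosed (k := ℂ) (by omega) hm) inferInstance
    (ιX (n + 1), m) (SmoothHypersurface.range_hypersurfaceι _) (p := p + 1) (by omega) hγ

/-- **The kernel of `H²ᵖ⁺²(Xⁿ⁺¹ₘ(ℂ)) → H²ᵖ⁺²(U_k(ℂ))` is the line spanned by an ambient class**:
for `2p < n` there is `γ ∈ H²ᵖ⁺²(ℙⁿ⁺²(ℂ))` with `ι^* γ ≠ 0` such that every class dying on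
`U_k(ℂ)` is a multiple of `ι^* γ`. [cite: Ran1980, §1 Lemma 1.4 and (1.5)] -/
theorem ker_restrictCompl_fermatCoordHyperplane_le_span (k : Fin (n + 3)) {p : ℕ} (hp : 2 * p < n) :
    ∃ γ : complexBetti (projectiveSpace (n + 2) ℂ) (2 * p + 2),
      complexBetti.map (ιX (n + 1), m) (2 * p + 2) γ ≠ 0 ∧
      LinearMap.ker (complexBetti.restrictCompl (𝕏 (n + 1), m)
          (fermatCoordHyperplane (n + 1) m k) (2 * p + 2)).hom ≤
        ℂ ∙ complexBetti.map (ιX (n + 1), m) (2 * p + 2) γ := by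
  have hX : IsSmoothProjective (n + 1) (𝕏 (n + 1), m) := isSmoothProjective_fermatHypersurface (by omega) hm
  obtain ⟨γ, hγ⟩ := exists_map_hypersurfaceι_ne_zero hn hm (p := p) (by omega)
  refine ⟨γ, hγ, ?_⟩
  set K := LinearMap.ker (complexBetti.restrictCompl (𝕏 (n + 1), m)
    (fermatCoordHyperplane (n + 1) m k) (2 * p + 2)).hom with hK
  set x₀ := complexBetti.map (ιX (n + 1), m) (2 * p + 2) γ with hx₀
  haveI := finite_complexBetti hX (2 * p + 2)
  have hx₀K : x₀ ∈ K := by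
    rw [hK, LinearMap.mem_ker]
    exact restrictCompl_fermatCoordHyperplane_map_eq_zero k (by omega) γ
  -- `K` is a line containing `x₀ ≠ 0`
  have hle := finrank_ker_restrictCompl_fermatCoordHyperplane_le_one hn hm k hp
  have hpos : 0 < Module.finrank ℂ K :=
    Module.finrank_pos_iff_exists_ne_zero.mpr ⟨⟨x₀, hx₀K⟩, fun h ↦ hγ (congrArg Subtype.val h)⟩
  have h1 : Module.finrank ℂ K = 1 := by
    change Module.finrank ℂ K ≤ 1 at hle
    omega
  intro c hc
  obtain ⟨t, ht⟩ := (finrank_eq_one_iff_of_nonzero' (⟨x₀, hx₀K⟩ : K)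
    (fun h ↦ hγ (congrArg Subtype.val h))).1 h1 ⟨c, hc⟩
  rw [Submodule.mem_span_singleton]
  exact ⟨t, congrArg Subtype.val ht⟩

/-- **The diagonal symmetries `μₘⁿ⁺³` act trivially on the kernel of restriction to `U_k(ℂ)`**:
a class `c ∈ H²ᵖ⁺²(Xⁿ⁺¹ₘ(ℂ); ℂ)`, `2p < n`, dying on `U_k(ℂ)` is a multiple of an ambient class,
which every `g_a` fixes (`map_diagonalMap_map_hypersurfaceι`). [cite: Ran1980, §1 Lemma 1.4 and (1.5)] -/
theorem map_diagonalMap_eq_self_of_restrictCompl_eq_zero (k : Fin (n + 3)) {p : ℕ} (hp : 2 * p < n)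
    (a : fermatGroup (n + 1) m) {c : complexBetti (𝕏 (n + 1), m) (2 * p + 2)}
    (hc : complexBetti.restrictCompl (𝕏 (n + 1), m) (fermatCoordHyperplane (n + 1) m k) (2 * p + 2) c = 0) :
    singularCohomology.map ℂ ℂ (diagonalMap (fermatPolynomial ℂ (n + 1) m)
        (fermatGroup_le_diagonalStabilizer m a.2)) (2 * p + 2) c = c := by
  obtain ⟨γ, -, hKle⟩ := ker_restrictCompl_fermatCoordHyperplane_le_span hn hm k hp
  have hcK : c ∈ LinearMap.ker (complexBetti.restrictCompl (𝕏 (n + 1), m)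
      (fermatCoordHyperplane (n + 1) m k) (2 * p + 2)).hom := hc
  obtain ⟨t, rfl⟩ := Submodule.mem_span_singleton.mp (hKle hcK)
  rw [map_smul, map_diagonalMap_map_hypersurfaceι]

omit hn hm in
/-- A non-zero `α ∈ (ℤ/m)ᴺ⁺²` gives a non-trivial character `χ_α` of `μₘᴺ⁺²`: some `a` has
`χ_α(a) ≠ 1` (`α ↦ χ_α` is injective and `χ_0 = 1`). [cite: Shioda1979HodgeFermat, §1] -/
theorem exists_fermatCharacter_ne_one [NeZero m] {N : ℕ} {α : Fin (N + 2) → ZMod m} (hα : α ≠ 0) :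
    ∃ a : fermatGroup N m, fermatCharacter m α a ≠ 1 := by
  by_contra h
  push Not at h
  apply hα
  apply fermatCharacter_injective (n := N) (m := m)
  ext a : 1
  rw [h a]
  simp [fermatCharacter_apply]

/-- **`V(α) ∩ ker (H²ᵖ⁺²(Xⁿ⁺¹ₘ(ℂ)) → H²ᵖ⁺²(U_k(ℂ))) = 0` for every character `α ≠ 0`**
(`n, m ≥ 1`, `2p < n`, any coordinate `k`): on the kernel `g_a^* = id`, on `V(α)`
`g_a^* = χ_α(a)`, and `χ_α(a) ≠ 1` for some `a`. In the middle degree `2p + 2 = n + 1` this is the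
injectivity of `V(α) → Hⁿ⁺¹(U_k(ℂ); ℂ)` used to bound `dim V(α)` by the multiplicities on the
affine Fermat variety. [cite: Ran1980, §1 (1.5) and Prop. 1.7 (i)] [cite: Aoki1987, p. 385] -/
theorem fermatEigenspace_inf_ker_restrictCompl_eq_bot (k : Fin (n + 3)) {p : ℕ} (hp : 2 * p < n)
    {α : Fin (n + 3) → ZMod m} (hα : α ≠ 0) :
    fermatEigenspace m α (2 * p + 2) ⊓
      LinearMap.ker (complexBetti.restrictCompl (𝕏 (n + 1), m)
        (fermatCoordHyperplane (n + 1) m k) (2 * p + 2)).hom = ⊥ := by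
  haveI : NeZero m := ⟨by omega⟩
  rw [eq_bot_iff]
  rintro c ⟨hcV, hcK⟩
  obtain ⟨a, ha⟩ := exists_fermatCharacter_ne_one (N := n + 1) hα
  have h1 := (mem_fermatEigenspace_iff.mp hcV) a
  rw [map_diagonalMap_eq_self_of_restrictCompl_eq_zero hn hm k hp a hcK] at h1
  -- `c = χ_α(a) • c` with `χ_α(a) ≠ 1`
  have h2 : ((fermatCharacter m α a : ℂˣ) : ℂ) - 1 ≠ 0 := by
    intro h0
    apply ha
    exact Units.val_injective (by simpa [sub_eq_zero] using h0)
  have h3 : (((fermatCharacter m α a : ℂˣ) : ℂ) - 1) • c = 0 := by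
    rw [sub_smul, one_smul, ← h1, sub_self]
  exact (smul_eq_zero.mp h3).resolve_left h2

/-- **Restriction to `U_k(ℂ)` is injective on `V(α)`, `α ≠ 0`** (`n, m ≥ 1`, `2p < n`).
[cite: Ran1980, §1 (1.5) and Prop. 1.7 (i)] [cite: Aoki1987, p. 385] -/
theorem restrictCompl_injOn_fermatEigenspace (k : Fin (n + 3)) {p : ℕ} (hp : 2 * p < n)
    {α : Fin (n + 3) → ZMod m} (hα : α ≠ 0) :
    Set.InjOn (complexBetti.restrictCompl (𝕏 (n + 1), m) (fermatCoordHyperplane (n + 1) m k) (2 * p + 2))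
      (fermatEigenspace m α (2 * p + 2)) := by
  intro c hc c' hc' h
  have hK : c - c' ∈ LinearMap.ker (complexBetti.restrictCompl (𝕏 (n + 1), m)
      (fermatCoordHyperplane (n + 1) m k) (2 * p + 2)).hom := by
    rw [LinearMap.mem_ker, map_sub, sub_eq_zero]
    exact h
  have hd : c - c' ∈ fermatEigenspace m α (2 * p + 2) ⊓
      LinearMap.ker (complexBetti.restrictCompl (𝕏 (n + 1), m)
        (fermatCoordHyperplane (n + 1) m k) (2 * p + 2)).hom :=
    Submodule.mem_inf.mpr ⟨Submodule.sub_mem _ hc hc', hK⟩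
  rw [fermatEigenspace_inf_ker_restrictCompl_eq_bot hn hm k hp hα] at hd
  exact sub_eq_zero.mp ((Submodule.mem_bot ℂ).mp hd)

omit hn in
/-- **General indexing** (dimension `N ≥ 2p + 2`, degree `d = 2p + 2`): for `m ≥ 1`, `α ≠ 0` and
any coordinate `k`, `V(α) ⊆ Hᵈ(Xᴺₘ(ℂ); ℂ)` meets the kernel of restriction to `U_k(ℂ)` trivially.
[cite: Ran1980, §1 (1.5) and Prop. 1.7 (i)] [cite: Aoki1987, p. 385] -/
theorem fermatEigenspace_inf_ker_restrictCompl_eq_bot' {N d p : ℕ} (hN : 2 * p + 2 ≤ N)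
    (hd : d = 2 * p + 2) (k : Fin (N + 2)) {α : Fin (N + 2) → ZMod m} (hα : α ≠ 0) :
    fermatEigenspace m α d ⊓
      LinearMap.ker (complexBetti.restrictCompl (𝕏 N, m) (fermatCoordHyperplane N m k) d).hom = ⊥ := by
  obtain ⟨n, rfl⟩ : ∃ n, N = n + 1 := ⟨N - 1, by omega⟩
  subst hd
  exact fermatEigenspace_inf_ker_restrictCompl_eq_bot (n := n) (by omega) hm k (by omega) hα

omit hn in
/-- **General indexing**: restriction to `U_k(ℂ)` is injective on `V(α) ⊆ Hᵈ(Xᴺₘ(ℂ); ℂ)` for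
`α ≠ 0`, `d = 2p + 2 ≤ N`, `m ≥ 1`. [cite: Ran1980, §1 (1.5) and Prop. 1.7 (i)] [cite: Aoki1987, p. 385] -/
theorem restrictCompl_injOn_fermatEigenspace' {N d p : ℕ} (hN : 2 * p + 2 ≤ N) (hd : d = 2 * p + 2)
    (k : Fin (N + 2)) {α : Fin (N + 2) → ZMod m} (hα : α ≠ 0) :
    Set.InjOn (complexBetti.restrictCompl (𝕏 N, m) (fermatCoordHyperplane N m k) d)
      (fermatEigenspace m α d) := by
  obtain ⟨n, rfl⟩ : ∃ n, N = n + 1 := ⟨N - 1, by omega⟩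
  subst hd
  exact restrictCompl_injOn_fermatEigenspace (n := n) (by omega) hm k (by omega) hα

omit hn in
/-- **Middle degree, even dimension `2r`** (the shape used by the consumers, `V(α) ⊆ H²ʳ(X²ʳₘ(ℂ))`):
for `r ≥ 1`, `m ≥ 1`, `α ≠ 0` and any coordinate `k`, restriction to `U_k(ℂ)` is injective on
`V(α)`. [cite: Ran1980, §1 Prop. 1.7 (i)] [cite: Aoki1987, p. 385] -/
theorem restrictCompl_injOn_fermatEigenspace_middle {r : ℕ} (hr : 1 ≤ r) (k : Fin (2 * r + 2))
    {α : Fin (2 * r + 2) → ZMod m} (hα : α ≠ 0) :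
    Set.InjOn (complexBetti.restrictCompl (𝕏 (2 * r), m) (fermatCoordHyperplane (2 * r) m k) (2 * r))
      (fermatEigenspace m α (2 * r)) :=
  restrictCompl_injOn_fermatEigenspace' hm (p := r - 1) (by omega) (by omega) k hα

omit hn in
/-- The same, kernel form: `V(α) ∩ ker (H²ʳ(X²ʳₘ(ℂ)) → H²ʳ(U_k(ℂ))) = 0`.
[cite: Ran1980, §1 Prop. 1.7 (i)] [cite: Aoki1987, p. 385] -/
theorem fermatEigenspace_inf_ker_restrictCompl_eq_bot_middle {r : ℕ} (hr : 1 ≤ r) (k : Fin (2 * r + 2))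
    {α : Fin (2 * r + 2) → ZMod m} (hα : α ≠ 0) :
    fermatEigenspace m α (2 * r) ⊓
      LinearMap.ker (complexBetti.restrictCompl (𝕏 (2 * r), m)
        (fermatCoordHyperplane (2 * r) m k) (2 * r)).hom = ⊥ :=
  fermatEigenspace_inf_ker_restrictCompl_eq_bot' hm (p := r - 1) (by omega) (by omega) k hα

end Fermat

end Literature.AlgebraicGeometry.HodgeTheory

end
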